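import Literature.MathematicalPhysics.QuantumManyBody.OneCoordinateMarginalStability
import HarnessLib

/-!
# Crux `RigidMomentumBound` (stmt-AtomisticToContinuum-13034), line `registered`:
# stub `stub_sliceStability` (G4b) — slice data are Lipschitz in the energy norm

Route `BECTangentRigidity`, problem `BoseEinsteinCondensation` of the summit `AtomisticToContinuum`;
support file for the line's skeleton (namespace `…Theorems.RigidMomentumBound`).

**Statement.** For a measurable pair potential `v` (hard cores allowed), a box of side `L > 0`, two
finite-energy trial states `Φ, Ψ : TrialState N L`, a coordinate `p = (i,k)` and
`Q = ∫(|∇(Φ-Ψ)|² + V|Φ-Ψ|²) < ∞`, `M = ∫|Φ-Ψ|²`, the one-coordinate slice data of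
`Literature/…/OneCoordinateMarginal.lean` satisfy
`∫₀ᴸ|e_Φ - e_Ψ| dt ≤ √Q·√(2(E_Φ+E_Ψ))` (full slice energy), the same bound for the normal slice
kinetic energy `e_t`, and `∫₀ᴸ|j_Φ - j_Ψ| dt ≤ √M·√E_Φ + √Q` (slice current).

**Proof.** All three estimates are the case `[a,b] = [0,L]` of the Literature theorems
`intervalIntegral_abs_sliceEnergyReal_sub_le`, `intervalIntegral_abs_normalSliceEnergyReal_sub_le`,
`intervalIntegral_abs_sliceCurrent_sub_le` of
`Literature/MathematicalPhysics/QuantumManyBody/OneCoordinateMarginalStability.lean` (Fubini along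
the coordinate: slice integrals are `L¹`-Lipschitz; pointwise
`||a|² - |b|²| ≤ |a-b|(|a|+|b|)` for every partial derivative and the potential term, a.e. where the
densities are finite; parametrised Cauchy–Schwarz `2∫|D| ≤ λ∫q + ∫e/λ`).
-/

noncomputable section

namespace Summit.AtomisticToContinuum.BoseEinsteinCondensation.Theorems.RigidMomentumBound

open MeasureTheory Filter Set
open scoped ENNReal NNReal BigOperators
open Literature.MathematicalPhysics.QuantumManyBody.BoseGas

/-- **G4b `stub_sliceStability`** (slice data are Lipschitz in the energy norm). For measurable `v`,
`0 < L`, finite-energy trial states `Φ, Ψ`, a coordinate `p` and finite energy norm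
`Q = ∫(|∇(Φ-Ψ)|² + V|Φ-Ψ|²)` of the difference:
`∫₀ᴸ|e_Φ - e_Ψ| ≤ √Q √(2(E_Φ + E_Ψ))`, `∫₀ᴸ|e_{t,Φ} - e_{t,Ψ}| ≤ √Q √(2(E_Φ + E_Ψ))` and
`∫₀ᴸ|j_Φ - j_Ψ| ≤ √(∫|Φ-Ψ|²) √E_Φ + √Q`. [folklore] -/
theorem stub_sliceStability :
    ∀ (v : ℝ → ℝ≥0∞), Measurable v → ∀ {N : ℕ} {L : ℝ}, 0 < L → ∀ (Φ Ψ : TrialState N L)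
      (p : Fin N × Fin 3), energy v Φ ≠ ⊤ → energy v Ψ ≠ ⊤ →
      (∫⁻ X, (kineticDensity (fun X => Φ.ψ X - Ψ.ψ X) X +
          interaction v X * (‖Φ.ψ X - Ψ.ψ X‖₊ : ℝ≥0∞) ^ 2)) ≠ ⊤ →
      (∫ t in (0 : ℝ)..L, |sliceEnergyReal v Φ.ψ p t - sliceEnergyReal v Ψ.ψ p t|) ≤
          Real.sqrt (∫⁻ X, (kineticDensity (fun X => Φ.ψ X - Ψ.ψ X) X +
              interaction v X * (‖Φ.ψ X - Ψ.ψ X‖₊ : ℝ≥0∞) ^ 2)).toReal *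
            Real.sqrt (2 * ((energy v Φ).toReal + (energy v Ψ).toReal)) ∧
      (∫ t in (0 : ℝ)..L, |normalSliceEnergyReal Φ.ψ p t - normalSliceEnergyReal Ψ.ψ p t|) ≤
          Real.sqrt (∫⁻ X, (kineticDensity (fun X => Φ.ψ X - Ψ.ψ X) X +
              interaction v X * (‖Φ.ψ X - Ψ.ψ X‖₊ : ℝ≥0∞) ^ 2)).toReal *
            Real.sqrt (2 * ((energy v Φ).toReal + (energy v Ψ).toReal)) ∧
      (∫ t in (0 : ℝ)..L, |sliceCurrent Φ.ψ p t - sliceCurrent Ψ.ψ p t|) ≤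
          Real.sqrt (∫⁻ X, (‖Φ.ψ X - Ψ.ψ X‖₊ : ℝ≥0∞) ^ 2).toReal * Real.sqrt (energy v Φ).toReal +
            Real.sqrt (∫⁻ X, (kineticDensity (fun X => Φ.ψ X - Ψ.ψ X) X +
              interaction v X * (‖Φ.ψ X - Ψ.ψ X‖₊ : ℝ≥0∞) ^ 2)).toReal := by
  intro v hv N L hL Φ Ψ p hΦ hΨ hQ
  exact ⟨intervalIntegral_abs_sliceEnergyReal_sub_le hv Φ Ψ p hΦ hΨ hQ hL.le,
    intervalIntegral_abs_normalSliceEnergyReal_sub_le hv Φ Ψ p hΦ hΨ hQ hL.le,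
    intervalIntegral_abs_sliceCurrent_sub_le hv Φ Ψ p hΦ hQ hL.le⟩

end Summit.AtomisticToContinuum.BoseEinsteinCondensation.Theorems.RigidMomentumBound

end
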